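import Summits.CriticalPhenomena.CardyFormulaZ2.Theorems.CardyUniqueLimitCardyRigidityDefs
import Summits.CriticalPhenomena.CardyFormulaZ2.Theorems.CardyUniqueLimitCardyRigidityDriverHalf
import Summits.CriticalPhenomena.CardyFormulaZ2.Theorems.CardyComplexConeParafermionToSLESixFamiliesPercDomainMarkov
import Literature.Probability.RandomPlanarGeometry.DrivingFunctionMeasurable
import HarnessLib

/-!
# The clock form of the slit-crossing data from a capacity clock and a slit-observable estimate

Crux `Summit.CriticalPhenomena.CardyFormulaZ2.Theses.CardyUniqueLimit.CardyRigidity`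
(stmt-CriticalPhenomena-0746), line `crossing_martingale`, stub `stub_slitCrossingData`.  With the
packaging `slitCrossing_data_of_clockForm` (…SlitCrossingClockForm.lean) the stub is its CLOCK
FORM `PercCrossingClockForm f` (below, a parametrised predicate: nothing is asserted).  This file
cuts the clock form into its two natural halves and PROVES the cut:

* `PercCapacityClock` (f-independent; shared verbatim in content with the clock clauses of
  `PercParaClockData` of crux stmt-CriticalPhenomena-11389): along the Kemppainen–Smirnov data and
  under the orientation hypothesis, eventually in `k`, an adapted CAPACITY CLOCK `θ` of the
  exploration filtration `explorationFiltration` — `θ_n` is the half-plane capacity time through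
  `φ_k` of the explored piece `γ[0, n+1]` off a small event —, with small start and increments,
  reaching any horizon `t` by a sure step bound `M_k`, for which the driving process
  `-drivingFunction φ_k ∘ bondInterfaceIn` is revealed by step `M_k` and local
  (Kemppainen–Smirnov box tightness + equicontinuity of the carriers; tree: `FKExplorationClock`,
  `…PercDrivingLocality`);
* `PercSlitObservableApprox f` (the percolation heart; Camia–Newman's Thm 3 transplanted): a
  bounded strongly measurable variable `X` (the indicator of the fixed crossing event) whose
  percolation SLIT EXPECTATIONS `percSlitExpectation … n X` (`…PercDomainMarkov.lean`: the
  conditional expectation given the prefix, everywhere defined) are, off a small event and for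
  describable interfaces, within `ε_k` of the level-stopped crossing observable of the
  sign-reversed discrete driving function at the capacity time `T` of `γ[0, n+1]`, whenever
  `T ≤ t'`;
* `percCrossingClockForm_of` — **PROVED**: the two halves give `PercCrossingClockForm f`
  (`E[X | 𝒢_n] = percSlitExpectation … n X` a.e. by the bridge clause of the clock; union of the
  bad events; the clock's identification feeds the estimate);
* `bridge_explorationFiltration` — the bridge clause for the exploration filtration itself
  (`condExp_explorationFiltration_ae_eq_percSlitExpectation`).
-/

noncomputable section

open MeasureTheory Filter Set Topology Metric
open scoped NNReal ENNReal
open UpperHalfPlane (upperHalfPlaneSet)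
open Literature.Probability Literature.Probability.RandomPlanarGeometry
  Literature.Probability.LatticeModels Literature.Probability.LatticeModels.DiscreteDobrushin
open Literature.Probability.Percolation (bondDomainCrossingProb bondInterfaceIn BondConfig
  bondPercolation half measurable_bondInterfaceIn)
open scoped Literature.Probability.RandomPlanarGeometry.PathBorel
open Summit.CriticalPhenomena.CardyFormulaZ2.Cruxes.ParafermionToSLESixFamilies.CaratheodoryNetSlitUniformity
  (percSlitExpectation condExp_explorationFiltration_ae_eq_percSlitExpectation)

namespace Summit.CriticalPhenomena.CardyFormulaZ2.Cruxes.CardyRigidity.CrossingMartingale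

/-- **The clock form of STUB A3** (`stub_slitCrossingData` is this through the landed
`slitCrossing_data_of_clockForm`): along the KS data and under the orientation hypothesis, for
admissible marks/levels and `s < t`, eventually in `k`: a filtration, an adapted clock `θ` with
step bound `M_k`, a real `X` with `|X| ≤ 1` a.e. (the conditional crossing probability frozen at
the level step), a small bad event, `𝒢_{M_k}`-measurability
and locality of `V^k = -drivingFunction φ_k ∘ bondInterfaceIn`, small start/increments of the
clock reaching `t` off `bad`, and `|E[X | 𝒢_n] - crossingObs f eval x m M d (θ_n) (V^k)| ≤ ε_k`
a.e. off `bad` for `n ≤ M_k`, `θ_n ≤ t + Δ_k`.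
(Sources: Camia–Newman 2007, §5 and Thm 3; Kemppainen–Smirnov 2017; Duminil-Copin–Smirnov 2012, Prop. 6.7.  A sub-goal
of the crux, stated as a predicate of this route — deliberately NOT a cited Literature fact.) -/
def PercCrossingClockForm (f : ℝ → ℝ) : Prop :=
    ∀ (D : DobrushinDomain) (E : ℝ → DiscreteDobrushin), ZdDiscretisationFamily D E →
    ∀ φ : ConformalEquiv upperHalfPlaneSet D.carrier, D.IsChordalUniformizing φ →
    ∀ δs : ℕ → ℝ, (∀ k, 0 < δs k) → Tendsto δs atTop (𝓝 0) →
      (∀ k, (E (δs k)).IsZdAdmissible) →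
      (∀ᶠ k in atTop, ∀ ω, bondInterfaceIn D (E (δs k)) ω =
        CurveClass.mk ⟨medialExplorationCurve (E (δs k)) ω⟩) →
    ∀ (Ds : ℕ → DobrushinDomain) (φs : ∀ k, ConformalEquiv upperHalfPlaneSet (Ds k).carrier),
      (∀ k, (Ds k).IsChordalUniformizing (φs k)) →
      (∀ R : ℝ, TendstoUniformlyOn (fun k ↦ (φs k).boundaryExtension) φ.boundaryExtension
        atTop ({z : ℂ | 0 ≤ z.im} ∩ closedBall 0 R)) →
      (∀ ε : ℝ, 0 < ε → ∃ r : ℝ, ∀ᶠ k in atTop, ∀ z : ℂ, z ∈ {z : ℂ | 0 ≤ z.im} → r ≤ ‖z‖ →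
        dist ((φs k).boundaryExtension z) ((Ds k).pt 1) ≤ ε) →
      Tendsto (fun k ↦ (Ds k).pt 1) atTop (𝓝 (D.pt 1)) →
      (∀ ε : ℝ≥0∞, 0 < ε → ∃ (δγ δW : ℕ → ℝ) (T : ℕ → ℝ≥0), (∀ j, 0 < δγ j) ∧
        (∀ j, 0 < δW j) ∧
        ∀ k, bondPercolation (zdGraph 2) half ((bondInterfaceIn D (E (δs k))) ⁻¹'
          ((fun p ↦ compactifiedClass (φs k).boundaryExtension ((Ds k).pt 1) p.1) ''
            {p : C(ℝ≥0, ℂ) × C(ℝ≥0, ℝ) | p ∈ generatedPairs ∧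
              p.1 ∈ Process.modulusSet ({0} : Set ℂ) δγ ∧
              p.2 ∈ Process.modulusSet ({0} : Set ℝ) δW ∧
              ∀ (j : ℕ) (t : ℝ≥0), T j ≤ t → (j : ℝ) ≤ ‖p.1 t‖})ᶜ) ≤ ε) →
    ∀ (x : Fin 3 → ℝ) (m M d : ℝ), AdmissibleLevels x m M d →
    ∀ s t : ℝ≥0, s < t →
      ∃ ε Δ η : ℕ → ℝ≥0, Tendsto ε atTop (𝓝 0) ∧ Tendsto Δ atTop (𝓝 0) ∧
        Tendsto η atTop (𝓝 0) ∧
        ∀ᶠ k in atTop, ∃ (𝒢 : Filtration ℕ (inferInstance : MeasurableSpace (BondConfig (Site 2))))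
          (θ : ℕ → BondConfig (Site 2) → ℝ≥0) (Mk : ℕ) (X : BondConfig (Site 2) → ℝ)
          (bad : Set (BondConfig (Site 2))),
          Adapted 𝒢 θ ∧ (∀ ω, ω ∉ bad → θ 0 ω ≤ Δ k) ∧
          (∀ u, Measurable[𝒢 Mk] fun ω ↦
            -drivingFunction (φs k) (bondInterfaceIn D (E (δs k)) ω) u) ∧
          (∀ n u, Measurable[𝒢 n] ({ω | u ≤ θ n ω}.indicator fun ω ↦
            -drivingFunction (φs k) (bondInterfaceIn D (E (δs k)) ω) u)) ∧
          (∀ᵐ ω ∂bondPercolation (zdGraph 2) half, |X ω| ≤ 1) ∧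
          MeasurableSet bad ∧ bondPercolation (zdGraph 2) half bad ≤ η k ∧
          (∀ ω, ω ∉ bad → ∃ n ≤ Mk, t ≤ θ n ω) ∧
          (∀ ω, ω ∉ bad → ∀ n, n < Mk → θ (n + 1) ω ≤ θ n ω + Δ k) ∧
          (∀ᵐ ω ∂bondPercolation (zdGraph 2) half, ω ∉ bad → ∀ n, n ≤ Mk → θ n ω ≤ t + Δ k →
            |(bondPercolation (zdGraph 2) half)[X|𝒢 n] ω -
              crossingObs f (fun (w : C(ℝ≥0, ℝ)) (r : ℝ≥0) ↦ w r) x m M d (θ n ω)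
                ⟨fun r ↦ -drivingFunction (φs k) (bondInterfaceIn D (E (δs k)) ω) r,
                  (continuous_drivingFunction (φs k) (bondInterfaceIn D (E (δs k)) ω)).neg⟩| ≤ ε k)

/-- **(P-clock) Capacity clocks of the bond-`ℤ²` exploration** (kernel-free; the clock clauses of
`PercParaClockData` of crux stmt-11389 with the identification of the clock made explicit):
along the KS data, under the orientation hypothesis, for every horizon `t`, eventually in `k`:
a filtration `𝒢` computing conditional expectations of bounded variables as the percolation
slit expectations of the exploration prefix (the exploration filtration `explorationFiltration`,
`condExp_explorationFiltration_ae_eq_percSlitExpectation`, or its augmentation by null sets),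
an adapted clock `θ` with sure step bound `M_k`, through which
`-drivingFunction φ_k ∘ bondInterfaceIn` is revealed by step `M_k` and local, and a measurable
`bad` of probability `≤ η_k → 0` off which the clock starts below `Δ_k → 0`, has increments
`≤ Δ_k`, reaches `t` by step `M_k`, the interface is describable through `φ_k`, and `θ_n` IS the
capacity time of the explored piece `γ[0, n+1]` for `n ≤ M_k`.
(Sources: Camia–Newman 2007, §5 and Thm 3; Kemppainen–Smirnov 2017; Duminil-Copin–Smirnov 2012, Prop. 6.7.  A sub-goal
of the crux, stated as a predicate of this route — deliberately NOT a cited Literature fact.) -/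
def PercCapacityClock : Prop :=
    ∀ (D : DobrushinDomain) (E : ℝ → DiscreteDobrushin), ZdDiscretisationFamily D E →
    ∀ φ : ConformalEquiv upperHalfPlaneSet D.carrier, D.IsChordalUniformizing φ →
    ∀ δs : ℕ → ℝ, (∀ k, 0 < δs k) → Tendsto δs atTop (𝓝 0) →
      ∀ hδadm : ∀ k, (E (δs k)).IsZdAdmissible,
      (∀ᶠ k in atTop, ∀ ω, bondInterfaceIn D (E (δs k)) ω =
        CurveClass.mk ⟨medialExplorationCurve (E (δs k)) ω⟩) →
    ∀ (Ds : ℕ → DobrushinDomain) (φs : ∀ k, ConformalEquiv upperHalfPlaneSet (Ds k).carrier),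
      (∀ k, (Ds k).IsChordalUniformizing (φs k)) →
      (∀ R : ℝ, TendstoUniformlyOn (fun k ↦ (φs k).boundaryExtension) φ.boundaryExtension
        atTop ({z : ℂ | 0 ≤ z.im} ∩ closedBall 0 R)) →
      (∀ ε : ℝ, 0 < ε → ∃ r : ℝ, ∀ᶠ k in atTop, ∀ z : ℂ, z ∈ {z : ℂ | 0 ≤ z.im} → r ≤ ‖z‖ →
        dist ((φs k).boundaryExtension z) ((Ds k).pt 1) ≤ ε) →
      Tendsto (fun k ↦ (Ds k).pt 1) atTop (𝓝 (D.pt 1)) →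
      (∀ ε : ℝ≥0∞, 0 < ε → ∃ (δγ δW : ℕ → ℝ) (T : ℕ → ℝ≥0), (∀ j, 0 < δγ j) ∧
        (∀ j, 0 < δW j) ∧
        ∀ k, bondPercolation (zdGraph 2) half ((bondInterfaceIn D (E (δs k))) ⁻¹'
          ((fun p ↦ compactifiedClass (φs k).boundaryExtension ((Ds k).pt 1) p.1) ''
            {p : C(ℝ≥0, ℂ) × C(ℝ≥0, ℝ) | p ∈ generatedPairs ∧
              p.1 ∈ Process.modulusSet ({0} : Set ℂ) δγ ∧
              p.2 ∈ Process.modulusSet ({0} : Set ℝ) δW ∧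
              ∀ (j : ℕ) (t : ℝ≥0), T j ≤ t → (j : ℝ) ≤ ‖p.1 t‖})ᶜ) ≤ ε) →
    ∀ t : ℝ≥0,
      ∃ Δ η : ℕ → ℝ≥0, Tendsto Δ atTop (𝓝 0) ∧ Tendsto η atTop (𝓝 0) ∧
        ∀ᶠ k in atTop, ∃ (𝒢 : Filtration ℕ (inferInstance : MeasurableSpace (BondConfig (Site 2))))
          (θ : ℕ → BondConfig (Site 2) → ℝ≥0) (Mk : ℕ) (bad : Set (BondConfig (Site 2))),
          (∀ g : BondConfig (Site 2) → ℝ, StronglyMeasurable g → (∀ ω, |g ω| ≤ 1) → ∀ n,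
            (bondPercolation (zdGraph 2) half)[g|𝒢 n] =ᵐ[bondPercolation (zdGraph 2) half]
              percSlitExpectation (hδadm k) half n g) ∧
          Adapted 𝒢 θ ∧ (∀ ω, ω ∉ bad → θ 0 ω ≤ Δ k) ∧
          (∀ u, Measurable[𝒢 Mk] fun ω ↦
            -drivingFunction (φs k) (bondInterfaceIn D (E (δs k)) ω) u) ∧
          (∀ n u, Measurable[𝒢 n] ({ω | u ≤ θ n ω}.indicator fun ω ↦
            -drivingFunction (φs k) (bondInterfaceIn D (E (δs k)) ω) u)) ∧
          MeasurableSet bad ∧ bondPercolation (zdGraph 2) half bad ≤ η k ∧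
          (∀ ω, ω ∉ bad → ∃ n ≤ Mk, t ≤ θ n ω) ∧
          (∀ ω, ω ∉ bad → ∀ n, n < Mk → θ (n + 1) ω ≤ θ n ω + Δ k) ∧
          (∀ ω, ω ∉ bad → IsLoewnerDescribable (φs k) (bondInterfaceIn D (E (δs k)) ω) ∧
            ∀ n, n ≤ Mk → (φs k).boundaryExtension ''
              (Loewner.trace (drivingFunction (φs k) (bondInterfaceIn D (E (δs k)) ω)) ''
                Icc 0 (θ n ω)) =
              range (polyline ((explorationPrefix (E (δs k)) n ω).map (medialPoint (E (δs k)).δ))))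

/-- **(P-approx) The slit crossing probabilities track the crossing observable** (the
percolation heart of the line: Camia–Newman's Theorem 3 with Smirnov's theorem replaced by the
all-rectangle hypothesis, along the discrete exploration).  Along the KS data, under the
orientation hypothesis, for admissible marks/levels and every horizon `t'`, eventually in `k`: a
strongly measurable `X` with `|X| ≤ 1` and a measurable `bad` of probability `≤ η_k → 0`, such
that for `ω ∉ bad` with describable interface and every depth `n` whose explored piece
`γ[0, n+1]` has capacity time `T ≤ t'` through `φ_k`, the percolation slit expectation of `X` at
depth `n` is within `ε_k → 0` of the LEVEL-STOPPED observable `crossingObs f eval x m M d T` of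
the sign-reversed discrete driving function.  The intended `X` is NOT the raw indicator `1_Q` of
the fixed crossing event `Q = {(u₂, u₁) ↔ (u₀, a) primal in the discrete domain}`,
`uᵢ = Φ_k(-xᵢ)`, but its conditional probability FROZEN at the discrete level step
`ν = min {n : θ_n ≥ ρ(-V^k)}` (a stopping step of the exploration filtration by locality):
`X = percSlitExpectation … ν 1_Q`, whose slit expectation at depth `n` is the free crossing
probability of the slit domain `Ω_δ ∖ γ[0, (n ∧ ν)+1]` between `(u₂, u₁)` and `(u₀, a) ∪` left
bank (domain Markov property, event identity, optional stopping), to be compared with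
`f(η_{T ∧ ρ})`; after the level step both sides are frozen.
(Sources: Camia–Newman 2007, §5 and Thm 3; Kemppainen–Smirnov 2017; Duminil-Copin–Smirnov 2012, Prop. 6.7.  A sub-goal
of the crux, stated as a predicate of this route — deliberately NOT a cited Literature fact.) -/
def PercSlitObservableApprox (f : ℝ → ℝ) : Prop :=
    ∀ (D : DobrushinDomain) (E : ℝ → DiscreteDobrushin), ZdDiscretisationFamily D E →
    ∀ φ : ConformalEquiv upperHalfPlaneSet D.carrier, D.IsChordalUniformizing φ →
    ∀ δs : ℕ → ℝ, (∀ k, 0 < δs k) → Tendsto δs atTop (𝓝 0) →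
      ∀ hδadm : ∀ k, (E (δs k)).IsZdAdmissible,
      (∀ᶠ k in atTop, ∀ ω, bondInterfaceIn D (E (δs k)) ω =
        CurveClass.mk ⟨medialExplorationCurve (E (δs k)) ω⟩) →
    ∀ (Ds : ℕ → DobrushinDomain) (φs : ∀ k, ConformalEquiv upperHalfPlaneSet (Ds k).carrier),
      (∀ k, (Ds k).IsChordalUniformizing (φs k)) →
      (∀ R : ℝ, TendstoUniformlyOn (fun k ↦ (φs k).boundaryExtension) φ.boundaryExtension
        atTop ({z : ℂ | 0 ≤ z.im} ∩ closedBall 0 R)) →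
      (∀ ε : ℝ, 0 < ε → ∃ r : ℝ, ∀ᶠ k in atTop, ∀ z : ℂ, z ∈ {z : ℂ | 0 ≤ z.im} → r ≤ ‖z‖ →
        dist ((φs k).boundaryExtension z) ((Ds k).pt 1) ≤ ε) →
      Tendsto (fun k ↦ (Ds k).pt 1) atTop (𝓝 (D.pt 1)) →
      (∀ ε : ℝ≥0∞, 0 < ε → ∃ (δγ δW : ℕ → ℝ) (T : ℕ → ℝ≥0), (∀ j, 0 < δγ j) ∧
        (∀ j, 0 < δW j) ∧
        ∀ k, bondPercolation (zdGraph 2) half ((bondInterfaceIn D (E (δs k))) ⁻¹'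
          ((fun p ↦ compactifiedClass (φs k).boundaryExtension ((Ds k).pt 1) p.1) ''
            {p : C(ℝ≥0, ℂ) × C(ℝ≥0, ℝ) | p ∈ generatedPairs ∧
              p.1 ∈ Process.modulusSet ({0} : Set ℂ) δγ ∧
              p.2 ∈ Process.modulusSet ({0} : Set ℝ) δW ∧
              ∀ (j : ℕ) (t : ℝ≥0), T j ≤ t → (j : ℝ) ≤ ‖p.1 t‖})ᶜ) ≤ ε) →
    ∀ (x : Fin 3 → ℝ) (m M d : ℝ), AdmissibleLevels x m M d →
    ∀ t' : ℝ≥0,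
      ∃ ε η : ℕ → ℝ≥0, Tendsto ε atTop (𝓝 0) ∧ Tendsto η atTop (𝓝 0) ∧
        ∀ᶠ k in atTop, ∃ (X : BondConfig (Site 2) → ℝ) (bad : Set (BondConfig (Site 2))),
          StronglyMeasurable X ∧ (∀ ω, |X ω| ≤ 1) ∧
          MeasurableSet bad ∧ bondPercolation (zdGraph 2) half bad ≤ η k ∧
          ∀ ω, ω ∉ bad → ∀ (n : ℕ) (T : ℝ≥0),
            IsLoewnerDescribable (φs k) (bondInterfaceIn D (E (δs k)) ω) →
            (φs k).boundaryExtension ''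
              (Loewner.trace (drivingFunction (φs k) (bondInterfaceIn D (E (δs k)) ω)) ''
                Icc 0 T) =
              range (polyline ((explorationPrefix (E (δs k)) n ω).map (medialPoint (E (δs k)).δ))) →
            T ≤ t' →
            |percSlitExpectation (hδadm k) half n X ω -
              crossingObs f (fun (w : C(ℝ≥0, ℝ)) (r : ℝ≥0) ↦ w r) x m M d T
                ⟨fun r ↦ -drivingFunction (φs k) (bondInterfaceIn D (E (δs k)) ω) r,
                  (continuous_drivingFunction (φs k) (bondInterfaceIn D (E (δs k)) ω)).neg⟩| ≤ ε k

/-- **The bridge clause holds for the exploration filtration**: conditional expectations of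
bounded strongly measurable real variables given `explorationFiltration … n` are a.e. the
percolation slit expectations (`condExp_explorationFiltration_ae_eq_percSlitExpectation`).
[cite: DuminilCopinSmirnov2012Clay, §6.2, Lemma 6.6] -/
theorem bridge_explorationFiltration {E₀ : DiscreteDobrushin} (hE₀ : E₀.IsZdAdmissible)
    (g : BondConfig (Site 2) → ℝ) (hg : StronglyMeasurable g) (hg1 : ∀ ω, |g ω| ≤ 1) (n : ℕ) :
    (bondPercolation (zdGraph 2) half)[g|explorationFiltration hE₀ n] =ᵐ[bondPercolation (zdGraph 2) half]
      percSlitExpectation hE₀ half n g :=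
  condExp_explorationFiltration_ae_eq_percSlitExpectation (hD := hE₀) half hg
    (fun ω ↦ by rw [Real.norm_eq_abs]; exact hg1 ω) n

/-- **The cut of the clock form is proved**: a capacity clock (P-clock) and the slit-observable
estimate (P-approx) give the clock form of STUB A3.  The conditional expectation of `X` given
`𝒢_n = explorationFiltration … n` is a.e. the percolation slit expectation
(`condExp_explorationFiltration_ae_eq_percSlitExpectation`, all `n` at once); the bad events are
united; the clock's identification clause turns the estimate at capacity times into the estimate
at `θ_n`. [cite: CamiaNewman2007, §5] -/
theorem percCrossingClockForm_of : ∀ {f : ℝ → ℝ}, PercCapacityClock → PercSlitObservableApprox f → PercCrossingClockForm f := by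
  intro f h1 h2 D E hE φ hφ δs hδpos hδ0 hδadm hor Ds φs hφs hU1 hU2 hb hbox x m M d hx s t hst
  obtain ⟨Δ, η₁, hΔ, hη₁, hev₁⟩ := h1 D E hE φ hφ δs hδpos hδ0 hδadm hor Ds φs hφs hU1 hU2 hb hbox t
  obtain ⟨ε, η₂, hε, hη₂, hev₂⟩ :=
    h2 D E hE φ hφ δs hδpos hδ0 hδadm hor Ds φs hφs hU1 hU2 hb hbox x m M d hx (t + 1)
  have hΔ1 : ∀ᶠ k in atTop, Δ k ≤ 1 := (hΔ.eventually_lt_const zero_lt_one).mono fun k hk ↦ hk.le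
  refine ⟨ε, Δ, fun k ↦ η₁ k + η₂ k, hε, hΔ, by simpa using hη₁.add hη₂, ?_⟩
  filter_upwards [hev₁, hev₂, hΔ1] with k hk₁ hk₂ hk₃
  obtain ⟨𝒢, θ, Mk, bad₁, hbridge, hθ, hθ0, hVM, hVloc, hbad₁, hPbad₁, hreach, hincr, hid⟩ := hk₁
  obtain ⟨X, bad₂, hXm, hX1, hbad₂, hPbad₂, happ⟩ := hk₂
  set P := bondPercolation (zdGraph 2) half with hP
  refine ⟨𝒢, θ, Mk, X, bad₁ ∪ bad₂, hθ,
    fun ω hω ↦ hθ0 ω fun h ↦ hω (Or.inl h), hVM, hVloc, Eventually.of_forall hX1,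
    hbad₁.union hbad₂, ?_, fun ω hω ↦ hreach ω fun h ↦ hω (Or.inl h),
    fun ω hω ↦ hincr ω fun h ↦ hω (Or.inl h), ?_⟩
  · calc P (bad₁ ∪ bad₂) ≤ P bad₁ + P bad₂ := measure_union_le _ _
      _ ≤ η₁ k + η₂ k := add_le_add hPbad₁ hPbad₂
      _ = ((η₁ k + η₂ k : ℝ≥0) : ℝ≥0∞) := (ENNReal.coe_add _ _).symm
  · -- `E[X | 𝒢_n] = percSlitExpectation … n X` a.e., for all `n`
    have hce : ∀ᵐ ω ∂P, ∀ n : ℕ, (P[X|𝒢 n]) ω = percSlitExpectation (hδadm k) half n X ω := by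
      rw [ae_all_iff]
      intro n
      exact hbridge X hXm hX1 n
    filter_upwards [hce] with ω hω hωbad n hn hθn
    rw [hω n]
    obtain ⟨hdesc, hidn⟩ := hid ω fun h ↦ hωbad (Or.inl h)
    refine happ ω (fun h ↦ hωbad (Or.inr h)) n (θ n ω) hdesc (hidn n hn) ?_
    calc θ n ω ≤ t + Δ k := hθn
      _ ≤ t + 1 := add_le_add le_rfl hk₃

end Summit.CriticalPhenomena.CardyFormulaZ2.Cruxes.CardyRigidity.CrossingMartingale

end
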